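/-
Copyright (c) 2026. All rights reserved.
Released under Apache 2.0 license as described in the file LICENSE.
Authors: abc-iut cell, prover seat abc-iut-L4-d2 (gen 7).
-/
import Literature.AnabelianGeometry.AbsoluteAnabelian.GaloisTheatersNumberFieldShadowTFPairs
import Literature.AnabelianGeometry.AbsoluteAnabelian.NumberFieldValuationProSetDecomposition
import Literature.AnabelianGeometry.AbsoluteAnabelian.NFDecompositionRelSlimProofs
import HarnessLib

/-!
# [AbsTopIII] Def 3.1 (ii) at the number-field shadow: MODEL MLF-Galois `TF`-pairs, their rigidity (Prop 3.2 (iv)), and the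
# `TF`-shadow vocabulary with the print-shape MLF-Galois-pair predicate

S. Mochizuki, *Topics in absolute anabelian geometry III* [MochizukiAbsTopIII2015], Def 3.1 (ii) p. 67 ("We shall refer to
any collection of data `(Π ↷ M)` consisting of a topological group `Π`, an object `M ∈ Ob(T)`, and a continuous action of `Π`
on `M` as an MLF-Galois `T`-pair if, for some model MLF-Galois `T`-pair `(Π_k ↷ M_k)` [where the notation is as in (i)], there
exist an isomorphism of topological groups `Π_k ⥲ Π` and an isomorphism of objects `M_k ⥲ M` of `T` that are compatible with
the respective actions of `Π_k`, `Π` on `M_k`, `M`" — used here at `T = TF`, where the model datum `M_k` is "the object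
determined by `k̄`", Def 3.1 (i) p. 66), Prop 3.2 (iv) p. 72 (gloss: automorphisms of an MLF-Galois pair acting trivially on the
Galois group are trivial), Def 5.1 (v) p. 117.  (v2: Def 3.1 (ii) re-quoted verbatim with the `TF`-specialisation moved outside
the quotation marks — referee abc-iut-ref-l L14-n5 site 2; declarations byte-identical to v1 p493095.)

The `TF`-shadow vocabulary `NumberFieldShadow.fieldShadowVocabulary F` (abc-iut-L4-d2 g7, p491073) records the MLF-Galois-pair
predicate as its GROUP-THEORETIC half only (`IsMLFGaloisType D`) — honest but weak: pairs with trivial action qualify, so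
Cor 5.2 (vii)'s faithfulness `PanalocalTPairHomDetermined` is false there.  THIS DEF-BEARING FILE adds the print-shape predicate:

* `IsShadowMLFGaloisTFPair act` — `(D ↷ M)` (a profinite group acting on an object of `CommRingCat`) is ISOMORPHIC TO A MODEL
  PAIR of the shadow: there are a topological embedding `ι : D ↪ G_ℚ` whose image is an OPEN subgroup of the decomposition group
  `D_ṽ ⊆ G_ℚ` of a nonarchimedean place `ṽ` of `ℚ̄`, and a ring isomorphism `ψ : M ≅ ℚ̄`, with `ψ (g · m) = ι(g) · ψ(m)` — the
  models being `(U ↷ ℚ̄)`, `U` open in `D_ṽ ≅ G_{ℚ_p-field}`, i.e. the algebraic part of print's `(G_k ↷ k̄)`;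
* `IsShadowMLFGaloisTFPair.isMLFGaloisType` — it implies the group-theoretic predicate (`D ≅ U`, open subgroups of MLF-type
  groups are MLF-type, Prop 5.8 (ii)); `IsShadowMLFGaloisTFPair.of_iso` — invariance along isomorphisms of pairs (Def 3.1 (ii)
  is "isomorphic to a model"); **`IsShadowMLFGaloisTFPair.eq_refl_of_equivariant` — Prop 3.2 (iv) / law (L) at the shadow, in the
  GENERAL form the conditional closers `_of_rigid` / `_of_kappaRigid` take as `hL`**: every equivariant automorphism of EVERY
  MLF-Galois `TF`-pair of the shadow is the identity (transport to the model, then RELATIVE SLIMNESS of decomposition groups,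
  [AbsAnab] Thm 1.1.1 (ii), `galoisNF_decomposition_relativelySlim_holds`);
* `isShadowMLFGaloisTFPair_fieldLocAct` — the canonical local pairs `(Π_{E,ṽ} ↷ ℚ̄)` of an admissible `Π_E` ARE model pairs
  (`ι :=` the `ℚ`-chart, injective on admissibles with open image);
* `fieldShadowVocabulary' F := { fieldShadowVocabulary F with IsMLFGaloisPair := IsShadowMLFGaloisTFPair }` and its canonical
  global `TF`-pair `fieldShadowGlobalTPair' F` (inhabited).

PROOF-ONLY sequel (`…TFPairsModelCor52.lean`): Cor 5.2 (iii)/(iv) rows F-0189/F-0190/F-0191/F-0192 at the primed vocabulary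
and Cor 5.2 (vii) faithfulness F-3089 `PanalocalTPairHomDetermined` there.  HONEST LABEL: shadow (`Δ = 1`), algebraic parts of
the completions, stub cyclotomes; NOT the genuine `(R, W)` (E-L4-13).  No `instance`/`notation`/attribute changes; nothing
here bears on [IUTchIII] Cor. 3.12 or takes a side; typed ≠ proved.
-/

noncomputable section

open scoped Pointwise Topology
open CategoryTheory NumberField Field

namespace Literature.AnabelianGeometry.AbsoluteAnabelian

namespace NumberFieldShadow

/-! ### Def 3.1 (ii): MLF-Galois `TF`-pairs of the shadow -/

/-- **Def 3.1 (ii) at the shadow — "`(D ↷ M)` is an MLF-Galois `TF`-pair"**: it is ISOMORPHIC TO A MODEL PAIR `(U ↷ ℚ̄)`, `U` an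
open subgroup of the decomposition group `D_ṽ ⊆ G_ℚ` of a nonarchimedean place `ṽ` of `ℚ̄`: there are a continuous injective
homomorphism `ι : D ↪ G_ℚ` with `ι(D) ⊆ D_ṽ` open in `D_ṽ` and a ring isomorphism `ψ : M ≅ ℚ̄` with `ψ(g · m) = ι(g) · ψ(m)`.
(Print, Def 3.1 (ii) at general `T`: "for some model MLF-Galois `T`-pair `(Π_k ↷ M_k)` [where the notation is as in (i)],
there exist an isomorphism of topological groups `Π_k ⥲ Π` and an isomorphism of objects `M_k ⥲ M` of `T` that are compatible
with the respective actions of `Π_k`, `Π` on `M_k`, `M`"; here `T = TF`, `M_k` = the object determined by `k̄`, and the shadow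
model = the algebraic part of `(G_k ↷ k̄)`.)
[cite: MochizukiAbsTopIII2015, Def 3.1 (ii) p.67] -/
def IsShadowMLFGaloisTFPair {D : ProfiniteGrp.{0}} {M : CommRingCat.{0}} (act : D →* Aut M) : Prop :=
  ∃ (A : NumberFieldValuationProSet.NonArch ℚ) (ι : D →ₜ* absoluteGaloisGroup ℚ)
    (ψ : M ≅ CommRingCat.of (AlgebraicClosure ℚ)),
    Function.Injective ι ∧ (∀ g : D, ι g ∈ decompositionGroupNF ℚ A.1) ∧
    IsOpen ((fun d : decompositionGroupNF ℚ A.1 => (d : absoluteGaloisGroup ℚ)) ⁻¹' Set.range ι) ∧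
    ∀ (g : D) (m : M), ψ.hom.hom ((act g).hom.hom m) = ι g • ψ.hom.hom m

namespace IsShadowMLFGaloisTFPair

variable {D : ProfiniteGrp.{0}} {M : CommRingCat.{0}} {act : D →* Aut M}

/-- **Def 3.1 (ii) is invariant under isomorphisms of pairs**: if `(D' ↷ N)` is an MLF-Galois `TF`-pair of the shadow and
`(e : D ≅ D', φ : M ≅ N)` intertwine `(D ↷ M)` with it, then `(D ↷ M)` is one (compose the model data with `(e, φ)`).
[cite: MochizukiAbsTopIII2015, Def 3.1 (ii) p.67] -/
theorem of_iso {D' : ProfiniteGrp.{0}} {N : CommRingCat.{0}} {b : D' →* Aut N} (hb : IsShadowMLFGaloisTFPair b)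
    (e : D ≃ₜ* D') (φ : M ≅ N) (h : ∀ g, (act g).hom ≫ φ.hom = φ.hom ≫ (b (e g)).hom) :
    IsShadowMLFGaloisTFPair act := by
  obtain ⟨A, ι, ψ, hinj, hmem, hopen, hact⟩ := hb
  refine ⟨A, ι.comp (e : D →ₜ* D'), φ ≪≫ ψ, hinj.comp e.injective, fun g => hmem (e g), ?_, fun g m => ?_⟩
  · have hr : Set.range (ι.comp (e : D →ₜ* D')) = Set.range ι := by
      ext x
      constructor
      · rintro ⟨g, rfl⟩
        exact ⟨e g, rfl⟩
      · rintro ⟨g', rfl⟩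
        refine ⟨e.symm g', ?_⟩
        change ι (e (e.symm g')) = ι g'
        rw [ContinuousMulEquiv.apply_symm_apply]
    rw [hr]
    exact hopen
  · have hg := congrArg (fun f : M ⟶ N => f.hom m) (h g)
    change φ.hom.hom ((act g).hom.hom m) = (b (e g)).hom.hom (φ.hom.hom m) at hg
    change ψ.hom.hom (φ.hom.hom ((act g).hom.hom m)) = ι (e g) • ψ.hom.hom (φ.hom.hom m)
    rw [hg, hact]

/-- **An MLF-Galois `TF`-pair of the shadow has a Galois group of MLF-Galois type** (`D ≅ ι(D)`, an open subgroup of the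
MLF-type group `D_ṽ`; open subgroups of MLF-type groups are MLF-type, Prop 5.8 (ii)) — so the print-shape predicate refines the
group-theoretic one of `fieldShadowVocabulary`. [cite: MochizukiAbsTopIII2015, Def 3.1 (ii) p.67] -/
theorem isMLFGaloisType (h : IsShadowMLFGaloisTFPair act) : IsMLFGaloisType D := by
  obtain ⟨A, ι, -, hinj, hmem, hopen, -⟩ := h
  -- the decomposition group as a profinite group of MLF type
  let Dsub : Subgroup (absoluteGaloisGroup ℚ) := decompositionGroupNF ℚ A.1
  have hD : (NumberField.valuationProSet ℚ).decomp (Sum.inr (Sum.inl A)) = Dsub :=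
    NumberFieldValuationProSet.decomp_inr_inl_eq_decompositionGroupNF ℚ A
  have hDc : IsClosed (Dsub : Set (absoluteGaloisGroup ℚ)) := hD ▸ (NumberField.valuationProSet ℚ).isClosed_decomp _
  let DP : ProfiniteGrp.{0} := ProfiniteGrp.ofClosedSubgroup (G := absoluteGaloisGrp ℚ) ⟨Dsub, hDc⟩
  have hDP : IsMLFGaloisType DP := by
    have key : ∀ (S : Subgroup (absoluteGaloisGroup ℚ)) (hS : (NumberField.valuationProSet ℚ).decomp (Sum.inr (Sum.inl A)) = S)
        (hc : IsClosed (S : Set (absoluteGaloisGroup ℚ))),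
        IsMLFGaloisType (ProfiniteGrp.ofClosedSubgroup (G := absoluteGaloisGrp ℚ) ⟨S, hc⟩) := by
      intro S hS hc
      subst hS
      exact NumberFieldValuationProSet.isMLFGaloisType_decomp_inr_inl ℚ A
    exact key Dsub hD hDc
  -- the open subgroup `ι(D)` of it
  let U : OpenSubgroup DP := ⟨ι.toMonoidHom.range.comap Dsub.subtype, hopen⟩
  have hU : IsMLFGaloisType (ProfiniteGrp.ofClosedSubgroup ⟨U.toSubgroup, U.isClosed⟩) :=
    Prop58ii.openSubgroup_isMLFGaloisType DP hDP U
  -- `D ≅ ι(D)`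
  let r : D →* U.toSubgroup :=
    { toFun := fun g => ⟨⟨ι g, hmem g⟩, ⟨g, rfl⟩⟩
      map_one' := Subtype.ext (Subtype.ext (map_one ι))
      map_mul' := fun a b => Subtype.ext (Subtype.ext (map_mul ι a b)) }
  have hrbij : Function.Bijective r := by
    refine ⟨fun a b hab => hinj ?_, fun u => ?_⟩
    · exact congrArg (fun x : U.toSubgroup => x.1.1) hab
    · obtain ⟨⟨d, hd⟩, ⟨g, hg⟩⟩ := u
      exact ⟨g, Subtype.ext (Subtype.ext hg)⟩
  let e₀ := MulEquiv.ofBijective r hrbij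
  have hc : Continuous e₀ := by
    refine Continuous.subtype_mk (Continuous.subtype_mk ?_ _) _
    exact ι.continuous
  let e : D ≃ₜ* U.toSubgroup :=
    { e₀ with
      continuous_toFun := hc
      continuous_invFun := Continuous.continuous_symm_of_equiv_compact_to_t2 (f := e₀.toEquiv) hc }
  exact IsMLFGaloisType.of_continuousMulEquiv hU e

/-- **Prop 3.2 (iv) / law (L) at the shadow: an automorphism of an MLF-Galois `TF`-pair of the shadow commuting with the
action is the identity** — in the general form the conditional closers `referencePairIsoUnique_of_rigid` /
`…_of_kappaRigid` take as hypothesis `hL`.  Proof: transport along `ψ` to an automorphism of `ℚ̄`, i.e. an element of `G_ℚ`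
(every field automorphism of `ℚ̄` is one), commuting with `ι(D)`, an open subgroup of a decomposition group; its centraliser
is trivial by RELATIVE SLIMNESS ([AbsAnab] Thm 1.1.1 (ii)). [cite: MochizukiAbsTopIII2015, Prop 3.2 (iv) p.72] -/
theorem eq_refl_of_equivariant (h : IsShadowMLFGaloisTFPair act) (α : M ≅ M)
    (hα : ∀ g, (act g).hom ≫ α.hom = α.hom ≫ (act g).hom) : α = Iso.refl M := by
  obtain ⟨A, ι, ψ, -, hmem, hopen, hact⟩ := h
  -- `γ := ψ⁻¹ ≫ α ≫ ψ`, an automorphism of `ℚ̄`, as an element `a ∈ G_ℚ`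
  let γ : (CommRingCat.of (AlgebraicClosure ℚ) : CommRingCat.{0}) ≅ CommRingCat.of (AlgebraicClosure ℚ) :=
    ψ.symm ≪≫ α ≪≫ ψ
  have hf : ∀ q : ℚ, γ.commRingCatIsoToRingEquiv (algebraMap ℚ (AlgebraicClosure ℚ) q) =
      algebraMap ℚ (AlgebraicClosure ℚ) q := fun q => by
    rw [eq_ratCast, map_ratCast]
  let a : absoluteGaloisGroup ℚ := (absoluteGaloisGroup.toAlgEquiv ℚ).symm (AlgEquiv.ofRingEquiv hf)
  have ha : ∀ x : AlgebraicClosure ℚ, a • x = γ.hom.hom x := fun _ => rfl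
  -- `γ` commutes with `ι(D)`
  have hinvhom : ∀ x, ψ.hom.hom (ψ.inv.hom x) = x := fun x =>
    congrArg (fun f : (CommRingCat.of (AlgebraicClosure ℚ) : CommRingCat.{0}) ⟶ _ => f.hom x) ψ.inv_hom_id
  have hhominv : ∀ m, ψ.inv.hom (ψ.hom.hom m) = m := fun m => congrArg (fun f : M ⟶ M => f.hom m) ψ.hom_inv_id
  have hact' : ∀ (g : D) (x : AlgebraicClosure ℚ), (act g).hom.hom (ψ.inv.hom x) = ψ.inv.hom (ι g • x) := by
    intro g x
    have e := hact g (ψ.inv.hom x)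
    rw [hinvhom] at e
    rw [← hhominv ((act g).hom.hom (ψ.inv.hom x)), e]
  have hαx : ∀ (g : D) (m : M), α.hom.hom ((act g).hom.hom m) = (act g).hom.hom (α.hom.hom m) := fun g m => by
    have e := congrArg (fun f : M ⟶ M => f.hom m) (hα g)
    exact e
  have hγ : ∀ (g : D) (x : AlgebraicClosure ℚ), γ.hom.hom (ι g • x) = ι g • γ.hom.hom x := by
    intro g x
    change ψ.hom.hom (α.hom.hom (ψ.inv.hom (ι g • x))) = ι g • ψ.hom.hom (α.hom.hom (ψ.inv.hom x))
    rw [← hact', hαx, hact]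
  -- hence `a` centralises the open subgroup `ι(D)` of the decomposition group: `a = 1`
  let Dsub : Subgroup (absoluteGaloisGroup ℚ) := decompositionGroupNF ℚ A.1
  let U : Subgroup Dsub := ι.toMonoidHom.range.comap Dsub.subtype
  have hslim := galoisNF_decomposition_relativelySlim_holds ℚ A.1 A.2 U hopen
  have hmemU : a ∈ Subgroup.centralizer (Dsub.subtype '' (U : Set Dsub)) := by
    rw [Subgroup.mem_centralizer_iff]
    rintro _ ⟨d, hd, rfl⟩
    obtain ⟨g, hg⟩ : (d : absoluteGaloisGroup ℚ) ∈ ι.toMonoidHom.range := hd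
    have hg' : ι g = d := hg
    refine (absoluteGaloisGroup.toAlgEquiv ℚ).injective (AlgEquiv.ext fun x => ?_)
    change (d : absoluteGaloisGroup ℚ) • (a • x) = a • ((d : absoluteGaloisGroup ℚ) • x)
    rw [← hg', ha, ha, hγ]
  rw [hslim, Subgroup.mem_bot] at hmemU
  have hγ1 : ∀ x, γ.hom.hom x = x := fun x => by rw [← ha, hmemU, one_smul]
  -- so `α = ψ ≫ γ ≫ ψ⁻¹ = 𝟙`
  ext m
  change α.hom.hom m = m
  have e := hγ1 (ψ.hom.hom m)
  change ψ.hom.hom (α.hom.hom (ψ.inv.hom (ψ.hom.hom m))) = ψ.hom.hom m at e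
  rw [hhominv] at e
  have e' := congrArg ψ.inv.hom e
  rwa [hhominv, hhominv] at e'

end IsShadowMLFGaloisTFPair

variable (F : Type) [Field F] [NumberField F]

/-- **The canonical local pairs `(Π_{E,ṽ} ↷ ℚ̄)` of an admissible `Π_E` are MLF-Galois `TF`-pairs of the shadow** (model data:
`ι :=` the `ℚ`-chart restricted to `Π_{E,ṽ}` — injective on admissibles, with image `ratChart(Π_E) ∩ D_ṽ` open in `D_ṽ` — and
`ψ := id`). [cite: MochizukiAbsTopIII2015, Def 3.1 (ii) p.67] -/
theorem isShadowMLFGaloisTFPair_fieldLocAct {E : FundamentalExtension.{0}} (hE : IsAdmissible F E)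
    (v : (contextProVal E).carrier) (hv : v ∈ (contextProVal E).non) :
    IsShadowMLFGaloisTFPair (fieldLocAct E v) := by
  obtain ⟨A, rfl⟩ : v ∈ Set.range (fun A : NumberFieldValuationProSet.NonArch ℚ =>
      (Sum.inr (Sum.inl A) : NumberFieldValuationProSet.Carrier ℚ)) := hv
  have hD : (NumberField.valuationProSet ℚ).decomp (Sum.inr (Sum.inl A)) = decompositionGroupNF ℚ A.1 :=
    NumberFieldValuationProSet.decomp_inr_inl_eq_decompositionGroupNF ℚ A
  have hmemD : ∀ g : E.arith, g ∈ (contextProVal E).decomp (Sum.inr (Sum.inl A)) ↔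
      ratChart E g ∈ decompositionGroupNF ℚ A.1 := by
    intro g
    change g ∈ ((NumberField.valuationProSet ℚ).comap (ratChart E)).decomp _ ↔ _
    rw [GaloisProSet.decomp_comap, Subgroup.mem_comap, hD]
    rfl
  let ι : (contextProVal E).decompGrp (Sum.inr (Sum.inl A)) →ₜ* absoluteGaloisGroup ℚ :=
    (ratChart E).comp ⟨((contextProVal E).decomp (Sum.inr (Sum.inl A))).subtype, continuous_subtype_val⟩
  have hι : ∀ g, ι g = ratChart E g.1 := fun _ => rfl
  refine ⟨A, ι, Iso.refl _, fun a b hab => Subtype.ext (ratChart_injective_of_isAdmissible F hE hab),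
    fun g => (hmemD g.1).mp g.2, ?_, fun g m => rfl⟩
  -- `ι(Π_{E,ṽ}) = ratChart(Π_E) ∩ D_ṽ` is open in `D_ṽ`
  have hr : (fun d : decompositionGroupNF ℚ A.1 => (d : absoluteGaloisGroup ℚ)) ⁻¹' Set.range ι =
      (fun d : decompositionGroupNF ℚ A.1 => (d : absoluteGaloisGroup ℚ)) ⁻¹'
        (((ratChart E).toMonoidHom.range : Subgroup (absoluteGaloisGroup ℚ)) : Set (absoluteGaloisGroup ℚ)) := by
    ext d
    constructor
    · rintro ⟨g, hg⟩
      exact ⟨g.1, hg⟩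
    · rintro ⟨g, hg⟩
      have hg' : ratChart E g = d := hg
      exact ⟨⟨g, (hmemD g).mpr (hg' ▸ d.2)⟩, hg'⟩
  rw [hr]
  exact (isOpen_range_ratChart_of_isAdmissible F hE).preimage continuous_subtype_val

/-! ### The `TF`-shadow vocabulary with the print-shape MLF-Galois-pair predicate -/

/-- **The `TF`-shadow vocabulary with the Def 3.1 (ii)-shape predicate**: `fieldShadowVocabulary F` with `IsMLFGaloisPair`
REPLACED by `IsShadowMLFGaloisTFPair` ("isomorphic to a model pair `(U ↷ ℚ̄)`"); all other data unchanged.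
[cite: MochizukiAbsTopIII2015, Def 5.1 (v) p.117] -/
def fieldShadowVocabulary' : TPairVocabulary (context F) .TF :=
  { fieldShadowVocabulary F with IsMLFGaloisPair := fun {_} {_} act => IsShadowMLFGaloisTFPair act }

/-- The primed vocabulary's MLF-Galois-pair predicate is `IsShadowMLFGaloisTFPair`. [cite: MochizukiAbsTopIII2015, Def 3.1 (ii) p.67] -/
theorem fieldShadowVocabulary'_isMLFGaloisPair {D : ProfiniteGrp.{0}} {M : CommRingCat.{0}} (act : D →* Aut M) :
    (fieldShadowVocabulary' F).IsMLFGaloisPair act ↔ IsShadowMLFGaloisTFPair act := Iff.rfl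

/-- The primed predicate implies the unprimed one. [cite: MochizukiAbsTopIII2015, Def 3.1 (ii) p.67] -/
theorem isMLFGaloisPair_of_isMLFGaloisPair' {D : ProfiniteGrp.{0}} {M : CommRingCat.{0}} (act : D →* Aut M)
    (h : (fieldShadowVocabulary' F).IsMLFGaloisPair act) : (fieldShadowVocabulary F).IsMLFGaloisPair act :=
  IsShadowMLFGaloisTFPair.isMLFGaloisType h

/-- The canonical local pairs of the shadow satisfy the primed predicate at admissible `Π_E`.
[cite: MochizukiAbsTopIII2015, Def 5.1 (v) p.117] -/
theorem isMLFGaloisPair'_fieldLocAct {E : FundamentalExtension.{0}} (hE : IsAdmissible F E)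
    (v : ((context F).proVal E).non) :
    (fieldShadowVocabulary' F).IsMLFGaloisPair ((fieldShadowVocabulary' F).locAct E v) :=
  isShadowMLFGaloisTFPair_fieldLocAct F hE v.1 v.2

/-- **The canonical global `TF`-pair `M⊚_TF(E_F)` over the primed vocabulary**: it is INHABITED.
[cite: MochizukiAbsTopIII2015, Cor 5.2 (iv) p.120] -/
def fieldShadowGlobalTPair' : GlobalTPair (fieldShadowVocabulary' F) :=
  (fieldShadowVocabulary' F).canonical (extension F) (isAdmissible_extension F) (isContGlob_fieldGlobAct F _)
    (fun v => isMLFGaloisPair'_fieldLocAct F (isAdmissible_extension F) v) (fun v => isAutHolPair_locKummer F _ v)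

/-- Global `TF`-pairs over the primed vocabulary exist. [cite: MochizukiAbsTopIII2015, Cor 5.2 (iv) p.120] -/
theorem nonempty_globalTPair_fieldShadow' : Nonempty (GlobalTPair (fieldShadowVocabulary' F)) :=
  ⟨fieldShadowGlobalTPair' F⟩

end NumberFieldShadow

end Literature.AnabelianGeometry.AbsoluteAnabelian

end
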